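/-
Copyright: statement-level skeleton of a published paper (lit-balaban cell, Phase-2 proof seat p18, gen 7). No claims beyond
what the kernel checks below.
-/
import Mathlib
import Literature.MathematicalPhysics.QuantumFieldTheory.Balaban1983to89.B3FreeLineAmplitude

/-!
# B3 — T. Bałaban, *(Higgs)₂,₃ quantum fields in a finite volume. III. Renormalization*, CMP **88** (1983) 411–445
[Balaban1983Higgs3] — Proposition 2.2 p. 428 with the (2.4) exception of Proposition 2.1: the graphs `G′∗` of the
integration by parts (2.8)/(2.9) over the generalized graphs with free line exponents, and (1.33) ordering by ordering

statement-level skeleton of published theorems with citation tags; proofs where landed; nothing here is a claim about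
the Yang–Mills mass gap

PDF held: `paper:balaban1983-higgs-2-3-quantum-fields-finite-volume` (journal page = PDF page + 410).

Part of the Phase-2 work on SKELETON row **B3.Prop2.2** (unit `lit-balaban-p18` gen 7, HOME `run/shared/lean/pub/lit-balaban/`;
the fold owner's closing item «free line exponent κ_l»): files `B3FreeLineDegrees` → `B3FreeLineAmplitude` → `B3FreeLineIBP`
(this file) → `B3Prop22FreeLines`; built on seat p19's chain (`B3AmpIBPAll`, `B3IBPDegrees`, `B3IBPKernelBounds`,
`B3AmpIBPBounds`, `B3Prop21Except24Ordering`, whose proofs are followed line by line) without editing it.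

WHAT IS REPRODUCED.  p. 425 [PDF 15]: *"this way we represent G′ as a sum of graphs {G′∗} … The effect of this
transformation is that the graphs (2.4) are replaced by the graphs with degree +1"*; p. 426: *"for each graph G′∗ the
subgraphs G₁, G₂, …, G_m = G′∗ defined as previously have positive degrees"*, *"if the propagator is differentiated, then for
each differentiation, there is an additional factor (L^jη)^{−1} on the right side"*; p. 428: *"Proposition 2.2. Proposition
2.1 holds for the described above generalized expressions and graphs."*  KERNEL-CHECKED HERE, for an IBP-ready amplitude
`A : IBPAmpK G κ` over the generalized graph `Counts.toModelK G κ` (line `l` of dimension `lineDim l + κ_l`): every term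
`G′∗_c` of p19's closed form (`B3AmpIBPAll`: sites `S ⊆ sites G`, choice `c`) is again an amplitude of the class `Amp`, over
the generalized graph of the MOVED count datum `moveCounts G S c` with the SAME extra exponents (**`IBPAmpK.term`**: its
kernels obey (2.10) with the moved dimensions `a_l + κ_l + 1` on the sites, `a_p + κ_p − #hits` elsewhere, constants
`× (1 + e^{δ₁})²` — `term_K_le`; its vertex functions the vertex bound `× cD` where differentiated — `term_u_le`); hence
**`E(G′(j)) = Σ_c E(G′∗_c(j))`** (`E_eq_sum_terms`), `prefM(G′∗_c) ≤ cD^m · prefM` (`term_prefM_le`), `Π C(G′∗_c) =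
(Π C)(1+e^{δ₁})^{2m}` (`term_prod_C`).  Then **(1.33) for the sum with fixed ordering l̃** for the generalized graphs with
extra exponents from a finite menu (`sum_abs_E_le_ordering`): if every component of the `G_i` along σ has positive degree
OR is a (2.4)-block of the generalized graph (`Is24K`), then `Σ_{j∈J(l̃)}|E(G(j), …)| ≤ #{G′∗}·(Π C_l)(1+e^{δ₁})^{2m}·
unifConst215K(d, L, m, δ₁, Dmin)·cD^m·prefM` — (2.7) (`relabelK`), (2.8)/(2.9) at the sites, (2.13) `Amp.abs_E_le` and (2.15)
`Model.ineq215_of_pos` for each `G′∗` (all blocks positive, `posK_moveCounts`), the constant uniform by `const215K_le`; and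
the sum over the `m!` orderings, **`abs_EtotM_le`**.  HONEST SCOPE: as in p19's files, the integration by parts is performed at
every isolated differentiated line along the ordering (a superset of the (2.4)-blocks, harmless for the others).
-/

open Finset

namespace Literature.MathematicalPhysics.QuantumFieldTheory.Balaban1983to89

namespace B3Ineq213

open B3Ineq215 B3FreeLine B3Sect2FirstEstimate

variable {V : Type} [Fintype V] [DecidableEq V] {m : ℕ}

namespace IBPAmpK

variable {G : Counts V m} {κ : Fin m → ℚ} (A : IBPAmpK G κ)

/-! ## The terms `G′∗_c` over the generalized graph are amplitudes of the class `Amp` -/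

section Terms

variable {S : Finset (Fin m)} {c : Fin m → Option (Fin m)}

/-- The vertex-field norms of the term: a factor `cD` where the vertex function was differentiated. [cite: Balaban1983Higgs3, (2.9) p.425] -/
noncomputable def NAc (S : Finset (Fin m)) (c : Fin m → Option (Fin m)) (v : V) : ℝ :=
  if (∃ l ∈ S, G.src l = v ∧ c l = none) then A.cD * A.NA v else A.NA v

/-- **The kernels of the term `c` obey (2.10) with the moved dimensions** (extra exponents unchanged) and the constants
`C_l (1 + e^{2δ₀})²`. [cite: Balaban1983Higgs3, (2.10) p.426] -/
theorem term_K_le (hS : S ⊆ sites G) (hc : c ∈ choices G.src G.tgt S) (q : Fin m) :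
    KBd (G.toModelK κ) A.k (A.C q * (1 + Esh (G.toModelK κ)) ^ 2) (((moveCounts G S c).toModelK κ).a q)
      (allK G.src G.tgt A.dir (((G.toModelK κ).L : ℝ) ^ A.k) A.Kb S c A.K q) := by
  have hS1 : ∀ l ∈ S, 1 ≤ G.diffOn (G.src l) l := fun l hl => (mem_sites.1 (hS hl)).2.1
  have hE := one_le_Esh (G.toModelK κ)
  have hCq : 0 ≤ A.C q := A.C_nonneg q
  have hC1 : A.C q ≤ A.C q * (1 + Esh (G.toModelK κ)) ^ 2 :=
    le_mul_of_one_le_right hCq (one_le_pow₀ (by linarith))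
  rw [toModelK_a_moveCounts G κ hS1 c q]
  by_cases hq : q ∈ S
  · -- a site line: `K♭`, dimension `a + κ + 1`
    have hsite := mem_sites.1 (hS hq)
    rw [if_pos hq, IBPAmp.nHit_of_mem hS hc hq, Nat.cast_zero, sub_zero]
    have hK : allK G.src G.tgt A.dir (((G.toModelK κ).L : ℝ) ^ A.k) A.Kb S c A.K q = A.Kb q := by simp [allK, hq]
    rw [hK]
    exact (A.Kb_le q hsite.1 hsite.2.1).mono hC1
  · rw [if_neg hq, add_zero, nHit_eq_codes G ((sites_isSiteSet G).mono hS) hc q]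
    unfold allK
    rw [if_neg hq]
    by_cases hloop : G.src q = G.tgt q
    · have hexp : ((if xcode G.src S c q = 2 then 1 else 0)
          + (if G.src q ≠ G.tgt q ∧ ycode G.src G.tgt S c q = 2 then 1 else 0) : ℕ) = nd (xcode G.src S c q) := by
        rw [if_neg (show ¬ (G.src q ≠ G.tgt q ∧ ycode G.src G.tgt S c q = 2) from fun h => h.1 hloop), add_zero]
        rfl
      rw [if_pos hloop, hexp]
      exact (A.budget q).apCode_bound_loop hCq (IBPAmp.xcode_le_two (G := G) (S := S) (c := c) q) _
    · rw [if_neg hloop]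
      have h := (A.budget q).apCode_bound hCq (IBPAmp.xcode_le_two (G := G) (S := S) (c := c) q)
        (IBPAmp.ycode_le_two (G := G) (S := S) (c := c) q) (A.dir (G.src q)) (A.dir (G.tgt q))
      simp only [nd, ne_eq, hloop, not_false_eq_true, true_and] at h ⊢
      exact h

/-- **The vertex functions of the term `c` obey the vertex bound** (`× cD` where differentiated).
[cite: Balaban1983Higgs3, (2.9) p.425] -/
theorem term_u_le (hS : S ⊆ sites G) (v : V) (x : Fin (G.toModelK κ).d → ℕ) :
    |allU G.src A.dir (((G.toModelK κ).L : ℝ) ^ A.k) S c A.u v x|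
      ≤ A.eRun ^ A.dv v * A.lamRun ^ A.ds v * A.NPhi v * A.NAc S c v
        * ((((G.toModelK κ).L : ℝ) ^ A.k)⁻¹) ^ ((moveCounts G S c).toModelK κ).e v := by
  have he : ((moveCounts G S c).toModelK κ).e v = (G.toModelK κ).e v := rfl
  rw [he]
  unfold allU NAc
  by_cases h1 : ∃ l ∈ S, G.src l = v
  · rw [if_pos h1]
    obtain ⟨l, hl, hlv⟩ := h1
    have hsite := mem_sites.1 (hS hl)
    by_cases h2 : ∃ l ∈ S, G.src l = v ∧ c l = none
    · rw [if_pos h2, if_pos h2, abs_neg, ← hlv]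
      calc |bdiffQ (((G.toModelK κ).L : ℝ) ^ A.k) (A.dir (G.src l)) (A.u (G.src l)) x|
          ≤ A.cD * (A.eRun ^ A.dv (G.src l) * A.lamRun ^ A.ds (G.src l) * A.NPhi (G.src l) * A.NA (G.src l)
              * ((((G.toModelK κ).L : ℝ) ^ A.k)⁻¹) ^ (G.toModelK κ).e (G.src l)) := A.du_le l hsite.1 hsite.2.1 x
        _ = _ := by ring
    · rw [if_neg h2, if_neg h2, abs_neg]
      exact A.u_le v _
  · have h2 : ¬ ∃ l ∈ S, G.src l = v ∧ c l = none := fun ⟨l, hl, hv, _⟩ => h1 ⟨l, hl, hv⟩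
    rw [if_neg h1, if_neg h2]
    exact A.u_le v x

/-- **The term `G′∗_c` as an amplitude of the class `Amp` over the generalized graph of the moved count datum** (same extra
exponents). [cite: Balaban1983Higgs3, (2.9) p.425] -/
noncomputable def term (hS : S ⊆ sites G) (hc : c ∈ choices G.src G.tgt S) : Amp ((moveCounts G S c).toModelK κ) where
  k := A.k
  box := A.box
  u := allU G.src A.dir (((G.toModelK κ).L : ℝ) ^ A.k) S c A.u
  K := allK G.src G.tgt A.dir (((G.toModelK κ).L : ℝ) ^ A.k) A.Kb S c A.K
  C := fun q => A.C q * (1 + Esh (G.toModelK κ)) ^ 2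
  eRun := A.eRun
  lamRun := A.lamRun
  dv := A.dv
  ds := A.ds
  NPhi := A.NPhi
  NA := A.NAc S c
  C_nonneg := fun q => mul_nonneg (A.C_nonneg q) (sq_nonneg _)
  eRun_nonneg := A.eRun_nonneg
  lamRun_nonneg := A.lamRun_nonneg
  NPhi_nonneg := A.NPhi_nonneg
  NA_nonneg := fun v => by
    unfold NAc
    split_ifs
    · exact mul_nonneg (le_trans zero_le_one A.one_le_cD) (A.NA_nonneg v)
    · exact A.NA_nonneg v
  e_nonneg := A.e_nonneg
  conn := A.conn
  u_le := A.term_u_le hS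
  K_le := fun q => A.term_K_le hS hc q

/-- The amplitude of the term at `j` is the raw sum of its closed-form data. [cite: Balaban1983Higgs3, (2.9) p.425] -/
theorem term_E (hS : S ⊆ sites G) (hc : c ∈ choices G.src G.tgt S) (j : Fin m → ℕ) : (A.term hS hc).E j
    = rawE (G.toModelK κ).L (G.toModelK κ).d A.k G.src G.tgt A.box
        (allU G.src A.dir (((G.toModelK κ).L : ℝ) ^ A.k) S c A.u)
        (allK G.src G.tgt A.dir (((G.toModelK κ).L : ℝ) ^ A.k) A.Kb S c A.K) j := rfl

/-- **`E(G′(j)) = Σ_c E(G′∗_c(j))`** over the generalized graph, each term an amplitude of the class `Amp` over the generalized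
graph of its moved count datum. [cite: Balaban1983Higgs3, (2.9) p.425] -/
theorem E_eq_sum_terms (hS : S ⊆ sites G) (j : Fin m → ℕ) :
    (A.toAmp : Amp (G.toModelK κ)).E j
      = ∑ c ∈ (choices G.src G.tgt S).attach, (A.term hS c.2 : Amp ((moveCounts G S c.1).toModelK κ)).E j := by
  have hS1 := fun l (hl : l ∈ S) => mem_sites.1 (hS hl)
  have hsum : ∑ c ∈ (choices G.src G.tgt S).attach, (A.term hS c.2).E j
      = ∑ c ∈ choices G.src G.tgt S, rawE (G.toModelK κ).L (G.toModelK κ).d A.k G.src G.tgt A.box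
          (allU G.src A.dir (((G.toModelK κ).L : ℝ) ^ A.k) S c A.u)
          (allK G.src G.tgt A.dir (((G.toModelK κ).L : ℝ) ^ A.k) A.Kb S c A.K) j :=
    sum_attach (choices G.src G.tgt S) fun c => rawE (G.toModelK κ).L (G.toModelK κ).d A.k G.src G.tgt A.box
      (allU G.src A.dir (((G.toModelK κ).L : ℝ) ^ A.k) S c A.u)
      (allK G.src G.tgt A.dir (((G.toModelK κ).L : ℝ) ^ A.k) A.Kb S c A.K) j
  rw [hsum]
  exact A.E_allSites A.dir A.Kb j S ((sites_isSiteSet G).mono hS)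
    (fun l hl x y => A.K_eq l (hS1 l hl).1 (hS1 l hl).2.1 (j l) x y) (fun l hl => A.u_face l (hS1 l hl).1 (hS1 l hl).2.1)

/-- `Π_v NAc v ≤ cD^m · Π_v NA v`. [cite: Balaban1983Higgs3, (2.9) p.425] -/
theorem prod_NAc_le : ∏ v, A.NAc S c v ≤ A.cD ^ m * ∏ v, (A.toAmp : Amp (G.toModelK κ)).NA v := by
  classical
  have hcD := A.one_le_cD
  have h1 : ∏ v, A.NAc S c v = (∏ v, (if (∃ l ∈ S, G.src l = v ∧ c l = none) then A.cD else 1)) * ∏ v, A.NA v := by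
    rw [← prod_mul_distrib]
    refine prod_congr rfl fun v _ => ?_
    unfold NAc
    split_ifs <;> simp
  rw [h1, prod_ite, prod_const_one, mul_one, prod_const]
  refine mul_le_mul_of_nonneg_right ?_ (prod_nonneg fun v _ => A.NA_nonneg v)
  exact pow_le_pow_right₀ hcD (IBPAmp.card_derived_le (G := G) (S := S) (c := c))

/-- **The prefactor of a term is at most `cD^m` times the prefactor of the amplitude.** [cite: Balaban1983Higgs3, (1.33) p.420] -/
theorem term_prefM_le (hS : S ⊆ sites G) (hc : c ∈ choices G.src G.tgt S) :
    (A.term hS hc).prefM ≤ A.cD ^ m * A.toAmp.prefM := by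
  show (A.term hS hc).eRun ^ (∑ v, (A.term hS hc).dv v) * (A.term hS hc).lamRun ^ (∑ v, (A.term hS hc).ds v)
      * Real.exp (-(((moveCounts G S c).toModelK κ).δ₀
          * boxTreeLen ((moveCounts G S c).toModelK κ).L (A.term hS hc).k (A.term hS hc).box))
      * (∏ v, (A.term hS hc).NPhi v) * ∏ v, (A.term hS hc).NA v
    ≤ A.cD ^ m * (A.eRun ^ (∑ v, A.dv v) * A.lamRun ^ (∑ v, A.ds v)
      * Real.exp (-((G.toModelK κ).δ₀ * boxTreeLen (G.toModelK κ).L A.k A.box)) * (∏ v, A.NPhi v) * ∏ v, A.NA v)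
  have hk : (A.term hS hc).k = A.k := rfl
  have hbox : (A.term hS hc).box = A.box := rfl
  have hδ : ((moveCounts G S c).toModelK κ).δ₀ = (G.toModelK κ).δ₀ := rfl
  have hL : ((moveCounts G S c).toModelK κ).L = (G.toModelK κ).L := rfl
  rw [hk, hbox, hδ, hL]
  have hmain := A.prod_NAc_le (S := S) (c := c)
  have h0 : 0 ≤ A.eRun ^ (∑ v, A.dv v) * A.lamRun ^ (∑ v, A.ds v)
      * Real.exp (-((G.toModelK κ).δ₀ * boxTreeLen (G.toModelK κ).L A.k A.box)) * (∏ v, A.NPhi v) := by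
    have := A.eRun_nonneg
    have := A.lamRun_nonneg
    have : 0 ≤ ∏ v, A.NPhi v := prod_nonneg fun v _ => A.NPhi_nonneg v
    positivity
  calc A.eRun ^ (∑ v, A.dv v) * A.lamRun ^ (∑ v, A.ds v)
        * Real.exp (-((G.toModelK κ).δ₀ * boxTreeLen (G.toModelK κ).L A.k A.box)) * (∏ v, A.NPhi v) * ∏ v, A.NAc S c v
      ≤ A.eRun ^ (∑ v, A.dv v) * A.lamRun ^ (∑ v, A.ds v)
        * Real.exp (-((G.toModelK κ).δ₀ * boxTreeLen (G.toModelK κ).L A.k A.box)) * (∏ v, A.NPhi v)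
        * (A.cD ^ m * ∏ v, A.NA v) := mul_le_mul_of_nonneg_left hmain h0
    _ = _ := by ring

/-- The product of the term's kernel constants. [cite: Balaban1983Higgs3, (2.13) p.426] -/
theorem term_prod_C (hS : S ⊆ sites G) (hc : c ∈ choices G.src G.tgt S) :
    ∏ q, (A.term hS hc).C q = (∏ q, A.C q) * ((1 + Esh (G.toModelK κ)) ^ 2) ^ m := by
  show ∏ q, A.C q * (1 + Esh (G.toModelK κ)) ^ 2 = _
  rw [prod_mul_distrib, prod_const, card_univ, Fintype.card_fin]

end Terms

/-! ## (1.33) for the sum with fixed ordering, the (2.4)-blocks admitted, extra exponents from a finite menu -/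

/-- **(1.33) for the sum with fixed ordering l̃ over the generalized graphs, with the (2.4) exception**: if the extra
exponents come from the menu `T` and every component of the subgraphs `G_1 ⊂ … ⊂ G_m` along σ has positive degree OR is a
(2.4)-block of the generalized graph, then `Σ_{j∈J(l̃)} |E(G(j), {□(v)}, Φ′, A)| ≤ #{G′∗} · (Π_l C_l)(1+e^{δ₁})^{2m} ·
unifConst215K(d, L, m, δ₁, Dmin T m) · cD^m · prefM` — (2.7), then (2.8)/(2.9) at the sites, then (2.13) and (2.15) for each
term `G′∗` (all of whose blocks have positive degree). [cite: Balaban1983Higgs3, Prop. 2.2 p.428] -/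
theorem sum_abs_E_le_ordering {T : Finset ℚ} (hκ : ∀ l, κ l ∈ T) (𝒜 : B3.Assignment m A.k) (σ : Equiv.Perm (Fin m))
    (hyp : ∀ i, i ≤ m → ∀ b ∈ ((relabelCounts G σ).toModelK (κ ∘ σ)).reps i,
      ((relabelCounts G σ).toModelK (κ ∘ σ)).Nontriv i b →
      Is24K (relabelCounts G σ) (κ ∘ σ) i b ∨ 0 < ((relabelCounts G σ).toModelK (κ ∘ σ)).D i b) :
    ∑ j ∈ 𝒜.J σ, |A.E (fun l => ((j l : Fin A.k) : ℕ))|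
      ≤ ((choices (relabelCounts G σ).src (relabelCounts G σ).tgt (sites (relabelCounts G σ))).card : ℝ)
        * (((∏ l, A.C l) * ((1 + Esh (G.toModelK κ)) ^ 2) ^ m) * unifConst215K G.d G.L m G.δ₁ ((Dmin T m : ℚ) : ℝ)
          * (A.cD ^ m * A.toAmp.prefM)) := by
  classical
  set Gs := relabelCounts G σ with hGs
  set As : IBPAmpK Gs (κ ∘ σ) := A.relabel σ with hAs
  set S := sites Gs with hSdef
  have hSsub : S ⊆ sites Gs := subset_refl _
  have hκs : ∀ i, (κ ∘ σ) i ∈ T := fun i => hκ (σ i)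
  -- the reading of `j ∈ J(l̃)` along σ is a member of `Mon m k`, injectively
  have hmem : ∀ j ∈ 𝒜.J σ, (fun i => ((j (σ i) : Fin A.k) : ℕ)) ∈ Model.Mon m A.k :=
    fun j hj => Model.mem_Mon_of_orderedAlong (𝒜.ordered σ j hj)
  have hinj : Set.InjOn (fun (j : Fin m → Fin A.k) (i : Fin m) => ((j (σ i) : Fin A.k) : ℕ)) ↑(𝒜.J σ) := by
    intro j _ j' _ h
    funext l
    have e := congrFun h (σ.symm l)
    simp only [Equiv.apply_symm_apply] at e
    exact Fin.ext e
  have hU0 : 0 ≤ unifConst215K G.d G.L m G.δ₁ ((Dmin T m : ℚ) : ℝ) :=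
    (unifConst215K_pos G.d_pos G.two_le_L m G.δ₁_pos (by exact_mod_cast Dmin_pos T m)).le
  -- each term: (2.13) termwise and (2.15), all blocks positive
  have hterm : ∀ c : {c // c ∈ choices Gs.src Gs.tgt S},
      ∑ j' ∈ Model.Mon m A.k, |(As.term hSsub c.2).E j'|
        ≤ ((∏ l, A.C l) * ((1 + Esh (G.toModelK κ)) ^ 2) ^ m) * unifConst215K G.d G.L m G.δ₁ ((Dmin T m : ℚ) : ℝ)
          * (A.cD ^ m * A.toAmp.prefM) := by
    intro c
    set Tc := As.term hSsub c.2 with hTc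
    have hpos := posK_moveCounts Gs (κ ∘ σ) c.2 hyp
    have h213 : ∀ j' ∈ Model.Mon m A.k,
        |Tc.E j'| ≤ (∏ q, Tc.C q) * Tc.prefM * ((moveCounts Gs S c.1).toModelK (κ ∘ σ)).W 0 A.k j' Tc.box := by
      intro j' hj'
      exact Tc.abs_E_le_prefM hj'
    have hW : ∑ j' ∈ Model.Mon m A.k, ((moveCounts Gs S c.1).toModelK (κ ∘ σ)).W 0 A.k j' Tc.box
        ≤ ((moveCounts Gs S c.1).toModelK (κ ∘ σ)).const215 :=
      ((moveCounts Gs S c.1).toModelK (κ ∘ σ)).ineq215_of_pos hpos A.k Tc.box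
    have hconst : ((moveCounts Gs S c.1).toModelK (κ ∘ σ)).const215
        ≤ unifConst215K G.d G.L m G.δ₁ ((Dmin T m : ℚ) : ℝ) :=
      const215K_le (moveCounts Gs S c.1) hκs hpos
    have hC : ∏ q, Tc.C q = (∏ l, A.C l) * ((1 + Esh (G.toModelK κ)) ^ 2) ^ m := by
      rw [hTc, As.term_prod_C hSsub c.2, ← A.toAmp.prod_C_relabelK σ]
      rfl
    have hpref : Tc.prefM ≤ A.cD ^ m * A.toAmp.prefM := As.term_prefM_le hSsub c.2
    have hC0 : 0 ≤ ∏ q, Tc.C q := prod_nonneg fun q _ => Tc.C_nonneg q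
    have hP0 : 0 ≤ Tc.prefM := Tc.prefM_nonneg
    calc ∑ j' ∈ Model.Mon m A.k, |Tc.E j'|
        ≤ ∑ j' ∈ Model.Mon m A.k, (∏ q, Tc.C q) * Tc.prefM
            * ((moveCounts Gs S c.1).toModelK (κ ∘ σ)).W 0 A.k j' Tc.box := sum_le_sum h213
      _ = (∏ q, Tc.C q) * Tc.prefM
            * ∑ j' ∈ Model.Mon m A.k, ((moveCounts Gs S c.1).toModelK (κ ∘ σ)).W 0 A.k j' Tc.box := by rw [mul_sum]
      _ ≤ (∏ q, Tc.C q) * Tc.prefM * unifConst215K G.d G.L m G.δ₁ ((Dmin T m : ℚ) : ℝ) :=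
          mul_le_mul_of_nonneg_left (hW.trans hconst) (mul_nonneg hC0 hP0)
      _ ≤ (∏ q, Tc.C q) * (A.cD ^ m * A.toAmp.prefM) * unifConst215K G.d G.L m G.δ₁ ((Dmin T m : ℚ) : ℝ) :=
          mul_le_mul_of_nonneg_right (mul_le_mul_of_nonneg_left hpref hC0) hU0
      _ = _ := by rw [hC]; ring
  -- assemble
  calc ∑ j ∈ 𝒜.J σ, |A.E (fun l => ((j l : Fin A.k) : ℕ))|
      = ∑ j ∈ 𝒜.J σ, |As.E (fun i => ((j (σ i) : Fin A.k) : ℕ))| := by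
        refine sum_congr rfl fun j _ => ?_
        rw [← A.toAmp.E_relabelK σ (fun l => ((j l : Fin A.k) : ℕ))]
        rfl
    _ ≤ ∑ j ∈ 𝒜.J σ, ∑ c ∈ (choices Gs.src Gs.tgt S).attach,
          |(As.term hSsub c.2).E (fun i => ((j (σ i) : Fin A.k) : ℕ))| := by
        refine sum_le_sum fun j _ => ?_
        rw [As.E_eq_sum_terms hSsub]
        exact abs_sum_le_sum_abs _ _
    _ = ∑ c ∈ (choices Gs.src Gs.tgt S).attach, ∑ j ∈ 𝒜.J σ,
          |(As.term hSsub c.2).E (fun i => ((j (σ i) : Fin A.k) : ℕ))| := sum_comm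
    _ ≤ ∑ c ∈ (choices Gs.src Gs.tgt S).attach, ∑ j' ∈ Model.Mon m A.k, |(As.term hSsub c.2).E j'| := by
        refine sum_le_sum fun c _ => ?_
        calc ∑ j ∈ 𝒜.J σ, |(As.term hSsub c.2).E (fun i => ((j (σ i) : Fin A.k) : ℕ))|
            = ∑ j' ∈ (𝒜.J σ).image (fun (j : Fin m → Fin A.k) (i : Fin m) => ((j (σ i) : Fin A.k) : ℕ)),
                |(As.term hSsub c.2).E j'| := by rw [sum_image hinj]
          _ ≤ ∑ j' ∈ Model.Mon m A.k, |(As.term hSsub c.2).E j'| := by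
              apply sum_le_sum_of_subset_of_nonneg
              · intro j' hj'
                obtain ⟨j, hj, rfl⟩ := mem_image.1 hj'
                exact hmem j hj
              · intro j' _ _
                exact abs_nonneg _
    _ ≤ ∑ _c ∈ (choices Gs.src Gs.tgt S).attach,
          ((∏ l, A.C l) * ((1 + Esh (G.toModelK κ)) ^ 2) ^ m) * unifConst215K G.d G.L m G.δ₁ ((Dmin T m : ℚ) : ℝ)
            * (A.cD ^ m * A.toAmp.prefM) :=
        sum_le_sum fun c _ => hterm c
    _ = _ := by rw [sum_const, card_attach, nsmul_eq_mul]

/-- The number of graphs `G′∗` along an ordering is at most `(m+1)^m` (p19's `IBPAmp.card_choices_le`). [cite: Balaban1983Higgs3, (2.9) p.425] -/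
theorem card_choices_relabel_le (σ : Equiv.Perm (Fin m)) :
    (choices (relabelCounts G σ).src (relabelCounts G σ).tgt (sites (relabelCounts G σ))).card ≤ (m + 1) ^ m :=
  IBPAmp.card_choices_le _ _ _

/-- **(1.33) for the total amplitude over the generalized graph, with the (2.4) exception** (the sum over the orderings
of `sum_abs_E_le_ordering`): `|E(G′, {□(v)}, Φ′, A)| ≤ m!·(m+1)^m·(Π_l C_l)(1+e^{δ₁})^{2m}·unifConst215K·cD^m·prefM`.
[cite: Balaban1983Higgs3, Prop. 2.2 p.428] -/
theorem abs_EtotM_le {T : Finset ℚ} (hκ : ∀ l, κ l ∈ T)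
    (hyp : ∀ σ : Equiv.Perm (Fin m), ∀ i, i ≤ m → ∀ b ∈ ((relabelCounts G σ).toModelK (κ ∘ σ)).reps i,
      ((relabelCounts G σ).toModelK (κ ∘ σ)).Nontriv i b →
      Is24K (relabelCounts G σ) (κ ∘ σ) i b ∨ 0 < ((relabelCounts G σ).toModelK (κ ∘ σ)).D i b) :
    |A.toAmp.EtotM| ≤ (m.factorial : ℝ) * ((m + 1) ^ m : ℕ)
      * (((∏ l, A.C l) * ((1 + Esh (G.toModelK κ)) ^ 2) ^ m) * unifConst215K G.d G.L m G.δ₁ ((Dmin T m : ℚ) : ℝ)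
          * (A.cD ^ m * A.toAmp.prefM)) := by
  classical
  set B := ((∏ l, A.C l) * ((1 + Esh (G.toModelK κ)) ^ 2) ^ m) * unifConst215K G.d G.L m G.δ₁ ((Dmin T m : ℚ) : ℝ)
    * (A.cD ^ m * A.toAmp.prefM) with hB
  have hB0 : 0 ≤ B := by
    rw [hB]
    have h1 : 0 ≤ ∏ l, A.C l := prod_nonneg fun l _ => A.C_nonneg l
    have h2 : 0 ≤ unifConst215K G.d G.L m G.δ₁ ((Dmin T m : ℚ) : ℝ) :=
      (unifConst215K_pos G.d_pos G.two_le_L m G.δ₁_pos (by exact_mod_cast Dmin_pos T m)).le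
    have h3 : 0 ≤ A.cD ^ m := pow_nonneg (le_trans zero_le_one A.one_le_cD) _
    have h4 := A.toAmp.prefM_nonneg
    positivity
  rw [A.toAmp.EtotM_eq_sum_E, B3.display27 (B3.Assignment.bySort m A.k)]
  calc |∑ σ : Equiv.Perm (Fin m), ∑ j ∈ (B3.Assignment.bySort m A.k).J σ, A.E (fun l => ((j l : Fin A.k) : ℕ))|
      ≤ ∑ σ : Equiv.Perm (Fin m), |∑ j ∈ (B3.Assignment.bySort m A.k).J σ, A.E (fun l => ((j l : Fin A.k) : ℕ))| :=
        abs_sum_le_sum_abs _ _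
    _ ≤ ∑ σ : Equiv.Perm (Fin m), ∑ j ∈ (B3.Assignment.bySort m A.k).J σ, |A.E (fun l => ((j l : Fin A.k) : ℕ))| :=
        sum_le_sum fun σ _ => abs_sum_le_sum_abs _ _
    _ ≤ ∑ σ : Equiv.Perm (Fin m), (((m + 1) ^ m : ℕ) : ℝ) * B := by
        refine sum_le_sum fun σ _ => (A.sum_abs_E_le_ordering hκ (B3.Assignment.bySort m A.k) σ (hyp σ)).trans ?_
        exact mul_le_mul_of_nonneg_right (by exact_mod_cast card_choices_relabel_le (G := G) σ) hB0
    _ = (m.factorial : ℝ) * ((m + 1) ^ m : ℕ) * B := by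
        rw [sum_const, card_univ, Fintype.card_perm, Fintype.card_fin, nsmul_eq_mul, mul_assoc]

end IBPAmpK

end B3Ineq213

end Literature.MathematicalPhysics.QuantumFieldTheory.Balaban1983to89
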